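import Summits.QuantumFields.YangMills.Theorems.CurvatureBoostCovariance.Negative.Unbundled
import Summits.QuantumFields.YangMills.Theorems.NPointIsotropy.Negative.NPointRegularJunk
import Summits.QuantumFields.YangMills.Theorems.PencilRigidityNPointIsotropyMopupHelpers
import Literature.MathematicalPhysics.QuantumFieldTheory.OSLorentzInvariance
import Mathlib.Geometry.Manifold.PartitionOfUnity

/-!
# Orbit continuation at every angle from the `e₀`-frame at angle `0` — stub `stub_orbitAllAngles`

Line `boosts-inherit-mirrors` of crux `MirrorModularBoosts.CurvatureBoostCovariance`
(stmt-QuantumFields-9663), Stub 3c of the registered skeleton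
`Cruxes/CurvatureBoostCovariance/Lines/boosts_inherit_mirrors.lean` (one of the four proved pieces of
Stub 3, `stub_orbitBandlimit`: the orbit function `θ ↦ 𝔖_N(R_θ · X)`, `R_θ = planeRot 0 θ` the rotation of
the `(x₀,x₁)`-plane of `ℝ⁴`, of a doubled test function is a trigonometric polynomial).

Statement (`stub_orbitAllAngles`).  Let `S₁` be a one-species Schwinger family on `ℝ⁴` with proper hypercubic
invariance on `⁰𝒮` (`Hypercubic S₁`).  Suppose the orbit function of every compactly supported test function of
degree `N` with `e₀`-GENERIC support (pairwise distinct `x₀`-coordinates) extends holomorphically to a strip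
`{|Re w| < ε}` around the angle `0`, with the bound `C e^{Nₑ |Im w|}` for a type `Nₑ` uniform in the test
function.  Then for every compactly supported `X` with PLANAR-GENERIC support (at every angle the rotated
configuration has pairwise distinct `x₀`- or pairwise distinct `x₁`-coordinates, point by point) and every angle
`θ₀`, the orbit function of `X` extends holomorphically to a strip around `θ₀`, with the same type `Nₑ`.

Proof (`OrbitBandlimit.localContinuation_allAngles`).  The support of `R_{θ₀} · X` is compact and covered by the
two open sets of `e₀`-generic and `e₁`-generic configurations (planar genericity at the angle `θ₀`), so a smooth
two-set partition (`OrbitBandlimit.exists_split_two`, smooth Urysohn on the model space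
`𝓘(ℝ, (ℝ⁴)^N)`) splits `R_{θ₀} · X = Y₀ + Y₁` with `Y₀` `e₀`-generic and `Y₁` `e₁`-generic, both compactly
supported.  The quarter turn `R_{π/2}` maps `e₁ ↦ e₀` up to sign, so `R_{π/2} · Y₁` is `e₀`-generic; it lies in
the proper signed-permutation group, so by `Hypercubic` the orbit function of the off-diagonal `Y₁` is
`π/2`-periodic (`OrbitBandlimit.orbit_add_pi_div_two`) and equals that of `R_{π/2} · Y₁`.  The hypothesis gives
local continuations `Φ₀`, `Φ₁` of the orbit functions of `Y₀` and `R_{π/2} · Y₁` near `0`; then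
`w ↦ Φ₀(w - θ₀) + Φ₁(w - θ₀)` continues the orbit function of `X` near `θ₀` (angle addition
`R_θ · X = R_{θ-θ₀} · (R_{θ₀} · X)`, `OrbitBandlimit.linActMulti_planeRot_add`), with constant `C₀ + C₁`.

Public helpers (sub-namespace `OrbitBandlimit`, reused by the sibling file of `stub_orbitBandlimit`): the
rotation lemmas `planeRot_add_apply`, `planeRot_add_symm_apply`, `linActMulti_planeRot_add`, `det_planeRot`,
`planeRot_quarter_axes`, `orbit_add_pi_div_two` (quarter-turn periodicity of orbit functions), and the support
bookkeeping `hasCompactSupport_linActMulti`, `mem_tsupport_of_linActMulti`, `isOpen_generic`, `exists_split_two`.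

References: K. Osterwalder, R. Schrader, Comm. Math. Phys. 31 (1973) §4; 42 (1975) §IV–V (local analytic
continuation in the rotation angle from time-ordered pieces); the smooth Urysohn lemma is Mathlib's
`exists_contMDiffMap_zero_one_nhds_of_isClosed`.
-/

noncomputable section

-- tree-known workaround (kept in every landed `Negative/*.lean` file):
attribute [-instance] SimplexCategory.instFintypeToTypeOrderHomFinHAddNatLenOfNat

namespace Summit.QuantumFields.YangMills.Theorems.CurvatureBoostCovariance.BoostsInheritMirrors

open scoped BigOperators SchwartzMap
open MeasureTheory Filter Topology
open Literature.MathematicalPhysics.QuantumLattice Literature.MathematicalPhysics.AQFT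
  Literature.MathematicalPhysics.QuantumFieldTheory
open Summit.QuantumFields.YangMills.Theorems.NPointIsotropy.Negative (E4)
open Summit.QuantumFields.YangMills.Theorems.CurvatureBoostCovariance.Negative (Hypercubic isOffDiagonal_linActMulti)
open Summit.QuantumFields.YangMills.Theorems.NPointIsotropy.ComplexRotationBandlimit.Mopup
  (det_eq_of_fix continuous_coord)

namespace OrbitBandlimit

variable {N : ℕ}

/-! ## Plane rotations compose; the quarter turn; periodicity of orbit functions -/

/-- Rotations of the `(x₀,x₁)`-plane compose by adding the angles: `R_{θ+φ} = R_φ ∘ R_θ`. -/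
theorem planeRot_add_apply (θ φ : ℝ) (x : E4) :
    planeRot (0 : Fin 3) (θ + φ) x = planeRot (0 : Fin 3) φ (planeRot (0 : Fin 3) θ x) := by
  ext j
  simp only [planeRot_apply, Real.cos_add, Real.sin_add, Fin.succ_zero_eq_one, if_true, if_false,
    one_ne_zero]
  split_ifs <;> ring

/-- The inverse rotations compose in the opposite order. -/
theorem planeRot_add_symm_apply (θ φ : ℝ) (y : E4) :
    (planeRot (0 : Fin 3) (θ + φ)).symm y =
      (planeRot (0 : Fin 3) θ).symm ((planeRot (0 : Fin 3) φ).symm y) := by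
  apply (planeRot (0 : Fin 3) (θ + φ)).injective
  rw [LinearIsometryEquiv.apply_symm_apply, planeRot_add_apply, LinearIsometryEquiv.apply_symm_apply,
    LinearIsometryEquiv.apply_symm_apply]

/-- The diagonal action of a composed rotation on test functions: `R_{θ+φ} · H = R_φ · (R_θ · H)`. -/
theorem linActMulti_planeRot_add (θ φ : ℝ) (H : 𝓢((Fin N → E4), ℂ)) :
    linActMulti (planeRot (0 : Fin 3) (θ + φ)) H =
      linActMulti (planeRot (0 : Fin 3) φ) (linActMulti (planeRot (0 : Fin 3) θ) H) := by
  ext x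
  simp only [linActMulti_apply, planeRot_add_symm_apply]

/-- A plane rotation fixes `e₂`. -/
theorem planeRot_single_two (φ : ℝ) :
    planeRot (0 : Fin 3) φ (EuclideanSpace.single 2 1) = EuclideanSpace.single 2 1 := by
  ext j
  fin_cases j <;> simp [planeRot_apply]

/-- A plane rotation fixes `e₃`. -/
theorem planeRot_single_three (φ : ℝ) :
    planeRot (0 : Fin 3) φ (EuclideanSpace.single 3 1) = EuclideanSpace.single 3 1 := by
  ext j
  fin_cases j <;> simp [planeRot_apply]

/-- Plane rotations have determinant one. -/
theorem det_planeRot (φ : ℝ) :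
    LinearMap.det ((planeRot (0 : Fin 3) φ).toLinearEquiv : E4 →ₗ[ℝ] E4) = 1 := by
  rw [det_eq_of_fix (planeRot (0 : Fin 3) φ) (planeRot_single_two φ) (planeRot_single_three φ)]
  simp [planeRot_apply]
  nlinarith [Real.cos_sq_add_sin_sq φ]

/-- The quarter turn `R_{π/2}` permutes the signed coordinate axes (`e₀ ↦ -e₁`, `e₁ ↦ e₀`, `e₂, e₃` fixed). -/
theorem planeRot_quarter_axes : ∀ i : Fin 4, ∃ j : Fin 4,
    planeRot (0 : Fin 3) (Real.pi / 2) (EuclideanSpace.single i 1) = EuclideanSpace.single j 1 ∨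
      planeRot (0 : Fin 3) (Real.pi / 2) (EuclideanSpace.single i 1) = -EuclideanSpace.single j 1 := by
  intro i
  fin_cases i
  · exact ⟨1, Or.inr (by ext j; fin_cases j <;> simp [planeRot_apply])⟩
  · exact ⟨0, Or.inl (by ext j; fin_cases j <;> simp [planeRot_apply])⟩
  · exact ⟨2, Or.inl (planeRot_single_two _)⟩
  · exact ⟨3, Or.inl (planeRot_single_three _)⟩

/-- **Quarter-turn periodicity.** Proper hypercubic invariance on `⁰𝒮` makes the orbit function
`θ ↦ 𝔖_N(R_θ · H)` of every off-diagonal `H` periodic with period `π/2`. -/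
theorem orbit_add_pi_div_two {S₁ : SchwingerFamily E4} (hhyp : Hypercubic S₁)
    {H : 𝓢((Fin N → E4), ℂ)} (hH : IsOffDiagonal H) (θ : ℝ) :
    S₁ N (linActMulti (planeRot (0 : Fin 3) (θ + Real.pi / 2)) H) =
      S₁ N (linActMulti (planeRot (0 : Fin 3) θ) H) := by
  rw [linActMulti_planeRot_add]
  exact hhyp _ (det_planeRot _) planeRot_quarter_axes N _ (isOffDiagonal_linActMulti hH _)

/-! ## Two frames and a smooth partition of unity -/

-- adapted from Literature/MathematicalPhysics/QuantumFieldTheory/OSEuclideanRotationGenerator.lean (`planeRot_symm_apply`)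
/-- The inverse of a plane rotation is the rotation by the opposite angle. -/
theorem planeRot_symm_apply' (θ : ℝ) (y : E4) :
    (planeRot (0 : Fin 3) θ).symm y = planeRot (0 : Fin 3) (-θ) y := by
  apply (planeRot (0 : Fin 3) θ).injective
  rw [LinearIsometryEquiv.apply_symm_apply]
  have h := planeRotLin_neg_apply_planeRotLin (0 : Fin 3) (-θ) y
  rw [neg_neg] at h
  exact h.symm

/-- `linActMulti L X` is `X` pulled back through the diagonal homeomorphism `y ↦ (L⁻¹ y_k)_k`. -/
theorem coe_linActMulti_eq_comp (L : E4 ≃ₗᵢ[ℝ] E4) (X : 𝓢((Fin N → E4), ℂ)) :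
    ((linActMulti L X : 𝓢((Fin N → E4), ℂ)) : (Fin N → E4) → ℂ) =
      (X : (Fin N → E4) → ℂ) ∘ (Homeomorph.piCongrRight fun _ : Fin N => L.symm.toHomeomorph) := by
  funext y
  rw [linActMulti_apply]
  rfl

/-- Rotated compactly supported test functions are compactly supported. -/
theorem hasCompactSupport_linActMulti (L : E4 ≃ₗᵢ[ℝ] E4) {X : 𝓢((Fin N → E4), ℂ)}
    (hX : HasCompactSupport (X : (Fin N → E4) → ℂ)) :
    HasCompactSupport ((linActMulti L X : 𝓢((Fin N → E4), ℂ)) : (Fin N → E4) → ℂ) := by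
  rw [coe_linActMulti_eq_comp]
  exact hX.comp_homeomorph _

/-- Points of the support of `L · X` come from points of the support of `X`. -/
theorem mem_tsupport_of_linActMulti (L : E4 ≃ₗᵢ[ℝ] E4) {X : 𝓢((Fin N → E4), ℂ)} {y : Fin N → E4}
    (hy : y ∈ tsupport ((linActMulti L X : 𝓢((Fin N → E4), ℂ)) : (Fin N → E4) → ℂ)) :
    (fun k => L.symm (y k)) ∈ tsupport (X : (Fin N → E4) → ℂ) := by
  rw [coe_linActMulti_eq_comp] at hy
  exact tsupport_comp_subset_preimage (X : (Fin N → E4) → ℂ)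
    (Homeomorph.piCongrRight fun _ : Fin N => L.symm.toHomeomorph).continuous hy

/-- The `e_r`-generic configurations (pairwise distinct `x_r`-coordinates) form an open set. -/
theorem isOpen_generic (r : Fin 4) : IsOpen {x : Fin N → E4 | ∀ i j : Fin N, i ≠ j → x i r ≠ x j r} := by
  simp only [Set.setOf_forall]
  refine isOpen_iInter_of_finite fun i => isOpen_iInter_of_finite fun j => ?_
  by_cases hij : i = j
  · simp [hij]
  · simpa [hij] using isOpen_ne_fun (continuous_coord i r) (continuous_coord j r)

/-- **Smooth two-set splitting of a compactly supported test function.**  If the (compact) support of `X` is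
covered by two open sets `U₀ ∪ U₁`, then `X = X₀ + X₁` with `Xᵢ` compactly supported and `tsupport Xᵢ ⊆ Uᵢ`
(smooth Urysohn lemma `exists_contMDiffMap_zero_one_nhds_of_isClosed` on the model space `𝓘(ℝ, (ℝ⁴)^N)`:
a smooth `f` vanishing near `tsupport X ∖ U₀` and equal to `1` near `tsupport X ∖ U₁`; `X₀ = f X`). -/
theorem exists_split_two {X : 𝓢((Fin N → E4), ℂ)} (hXc : HasCompactSupport (X : (Fin N → E4) → ℂ))
    {U₀ U₁ : Set (Fin N → E4)} (hU₀ : IsOpen U₀) (hU₁ : IsOpen U₁)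
    (hcov : tsupport (X : (Fin N → E4) → ℂ) ⊆ U₀ ∪ U₁) :
    ∃ X₀ X₁ : 𝓢((Fin N → E4), ℂ), X = X₀ + X₁ ∧
      HasCompactSupport (X₀ : (Fin N → E4) → ℂ) ∧ tsupport (X₀ : (Fin N → E4) → ℂ) ⊆ U₀ ∧
      HasCompactSupport (X₁ : (Fin N → E4) → ℂ) ∧ tsupport (X₁ : (Fin N → E4) → ℂ) ⊆ U₁ := by
  set K : Set (Fin N → E4) := tsupport (X : (Fin N → E4) → ℂ) with hK
  have hKcl : IsClosed K := isClosed_tsupport _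
  have hs : IsClosed (K \ U₀) := hKcl.sdiff hU₀
  have ht : IsClosed (K \ U₁) := hKcl.sdiff hU₁
  have hd : Disjoint (K \ U₀) (K \ U₁) := by
    rw [Set.disjoint_left]
    rintro x ⟨hxK, hx0⟩ ⟨-, hx1⟩
    rcases hcov hxK with h | h
    · exact hx0 h
    · exact hx1 h
  obtain ⟨f, hf0, hf1, -⟩ := exists_contMDiffMap_zero_one_nhds_of_isClosed
    (modelWithCornersSelf ℝ (Fin N → E4)) (n := (⊤ : ℕ∞)) hs ht hd
  have hfs : ContDiff ℝ (⊤ : ℕ∞) (f : (Fin N → E4) → ℝ) := f.contMDiff.contDiff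
  obtain ⟨W₀, hW₀o, hW₀s, hW₀f⟩ := mem_nhdsSet_iff_exists.1 hf0
  obtain ⟨W₁, hW₁o, hW₁s, hW₁f⟩ := mem_nhdsSet_iff_exists.1 hf1
  -- the cut-off piece `X₀ = f · X`
  have hc0 : HasCompactSupport fun x : Fin N → E4 => ((f x : ℝ) : ℂ) * X x := hXc.mul_left
  have hs0 : ContDiff ℝ (⊤ : ℕ∞) fun x : Fin N → E4 => ((f x : ℝ) : ℂ) * X x :=
    (Complex.ofRealCLM.contDiff.comp hfs).mul (X.smooth _)
  set X₀ : 𝓢((Fin N → E4), ℂ) := hc0.toSchwartzMap hs0 with hX₀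
  have hX₀_apply : ∀ x, X₀ x = ((f x : ℝ) : ℂ) * X x := fun x => rfl
  have hX₁_apply : ∀ x, (X - X₀) x = (1 - ((f x : ℝ) : ℂ)) * X x := fun x => by
    show X x - X₀ x = _
    rw [hX₀_apply]; ring
  have hXK : ∀ x, X x ≠ 0 → x ∈ K := fun x hx => subset_tsupport _ (Function.mem_support.2 hx)
  refine ⟨X₀, X - X₀, by abel, hc0, ?_, ?_, ?_⟩
  · -- `tsupport X₀ ⊆ K ∩ W₀ᶜ ⊆ U₀`
    have hsub : Function.support (X₀ : (Fin N → E4) → ℂ) ⊆ K ∩ W₀ᶜ := by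
      intro x hx
      rw [Function.mem_support, hX₀_apply] at hx
      refine ⟨hXK x (right_ne_zero_of_mul hx), fun hxW => left_ne_zero_of_mul hx ?_⟩
      rw [show f x = 0 from hW₀f hxW, Complex.ofReal_zero]
    intro x hx
    obtain ⟨hxK, hxW⟩ := closure_minimal hsub (hKcl.inter hW₀o.isClosed_compl) hx
    by_contra hxU
    exact hxW (hW₀s ⟨hxK, hxU⟩)
  · refine HasCompactSupport.intro hXc fun x hx => ?_
    rw [hX₁_apply, image_eq_zero_of_notMem_tsupport hx, mul_zero]
  · -- `tsupport (X - X₀) ⊆ K ∩ W₁ᶜ ⊆ U₁`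
    have hsub : Function.support ((X - X₀ : 𝓢((Fin N → E4), ℂ)) : (Fin N → E4) → ℂ) ⊆ K ∩ W₁ᶜ := by
      intro x hx
      rw [Function.mem_support, hX₁_apply] at hx
      refine ⟨hXK x (right_ne_zero_of_mul hx), fun hxW => left_ne_zero_of_mul hx ?_⟩
      rw [show f x = 1 from hW₁f hxW, Complex.ofReal_one, sub_self]
    intro x hx
    obtain ⟨hxK, hxW⟩ := closure_minimal hsub (hKcl.inter hW₁o.isClosed_compl) hx
    by_contra hxU
    exact hxW (hW₁s ⟨hxK, hxU⟩)

/-- **From the `e₀`-frame at angle `0` to every angle**, the open-binder form of `stub_orbitAllAngles` (see the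
module docstring for the proof). -/
theorem localContinuation_allAngles {S₁ : SchwingerFamily E4} (hhyp : Hypercubic S₁) (Nₑ : ℝ)
    (h0 : ∀ X : 𝓢((Fin N → E4), ℂ), HasCompactSupport (X : (Fin N → E4) → ℂ) →
      tsupport (X : (Fin N → E4) → ℂ) ⊆ {x | ∀ i j : Fin N, i ≠ j → x i 0 ≠ x j 0} →
      ∃ ε : ℝ, 0 < ε ∧ ∃ (Φ : ℂ → ℂ) (C : ℝ), DifferentiableOn ℂ Φ {w : ℂ | |w.re| < ε} ∧
        (∀ w : ℂ, |w.re| < ε → ‖Φ w‖ ≤ C * Real.exp (Nₑ * |w.im|)) ∧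
        ∀ θ : ℝ, |θ| < ε → Φ θ = S₁ N (linActMulti (planeRot (0 : Fin 3) θ) X))
    (X : 𝓢((Fin N → E4), ℂ)) (hXc : HasCompactSupport (X : (Fin N → E4) → ℂ))
    (hXg : ∀ x ∈ tsupport (X : (Fin N → E4) → ℂ), ∀ φ : ℝ,
      (∀ i j : Fin N, i ≠ j → (planeRot (0 : Fin 3) φ (x i)) 0 ≠ (planeRot (0 : Fin 3) φ (x j)) 0) ∨
      (∀ i j : Fin N, i ≠ j → (planeRot (0 : Fin 3) φ (x i)) 1 ≠ (planeRot (0 : Fin 3) φ (x j)) 1))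
    (θ₀ : ℝ) :
    ∃ ε : ℝ, 0 < ε ∧ ∃ (Φ : ℂ → ℂ) (C : ℝ), DifferentiableOn ℂ Φ {w : ℂ | |w.re - θ₀| < ε} ∧
      (∀ w : ℂ, |w.re - θ₀| < ε → ‖Φ w‖ ≤ C * Real.exp (Nₑ * |w.im|)) ∧
      ∀ θ : ℝ, |θ - θ₀| < ε → Φ θ = S₁ N (linActMulti (planeRot (0 : Fin 3) θ) X) := by
  -- the support of `R_{θ₀} · X` is covered by the `e₀`-generic and the `e₁`-generic open sets
  have hYc : HasCompactSupport
      ((linActMulti (planeRot (0 : Fin 3) θ₀) X : 𝓢((Fin N → E4), ℂ)) : (Fin N → E4) → ℂ) :=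
    hasCompactSupport_linActMulti _ hXc
  have hcov : tsupport ((linActMulti (planeRot (0 : Fin 3) θ₀) X : 𝓢((Fin N → E4), ℂ)) : (Fin N → E4) → ℂ) ⊆
      {x | ∀ i j : Fin N, i ≠ j → x i 0 ≠ x j 0} ∪ {x | ∀ i j : Fin N, i ≠ j → x i 1 ≠ x j 1} := by
    intro y hy
    have hx := hXg _ (mem_tsupport_of_linActMulti _ hy) θ₀
    simp only [LinearIsometryEquiv.apply_symm_apply] at hx
    exact hx
  obtain ⟨Y₀, Y₁, hYsum, hY₀c, hY₀s, hY₁c, hY₁s⟩ :=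
    exists_split_two hYc (isOpen_generic 0) (isOpen_generic 1) hcov
  -- the `e₀`-generic part
  obtain ⟨ε₀, hε₀, Φ₀, C₀, hd₀, hg₀, hf₀⟩ := h0 Y₀ hY₀c hY₀s
  -- the `e₁`-generic part after a quarter turn
  have hZc : HasCompactSupport
      ((linActMulti (planeRot (0 : Fin 3) (Real.pi / 2)) Y₁ : 𝓢((Fin N → E4), ℂ)) : (Fin N → E4) → ℂ) :=
    hasCompactSupport_linActMulti _ hY₁c
  have hZs : tsupport ((linActMulti (planeRot (0 : Fin 3) (Real.pi / 2)) Y₁ : 𝓢((Fin N → E4), ℂ)) :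
      (Fin N → E4) → ℂ) ⊆ {x | ∀ i j : Fin N, i ≠ j → x i 0 ≠ x j 0} := by
    intro z hz i j hij
    have h := hY₁s (mem_tsupport_of_linActMulti _ hz) i j hij
    simp only [planeRot_symm_apply', planeRot_apply, Fin.succ_zero_eq_one, Real.sin_neg, Real.cos_neg,
      Real.sin_pi_div_two, Real.cos_pi_div_two] at h
    simpa using h
  obtain ⟨ε₁, hε₁, Φ₁, C₁, hd₁, hg₁, hf₁⟩ := h0 _ hZc hZs
  -- `Y₁` is off-diagonal, so its orbit function is `π/2`-periodic and equals that of `R_{π/2} · Y₁`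
  have hY₁off : IsOffDiagonal Y₁ := by
    refine IsOffDiagonal.of_tsupport_subset (hY₁s.trans ?_)
    rintro x hx ⟨i, j, hij, hxij⟩
    exact hx i j hij (by rw [hxij])
  have horb₁ : ∀ θ : ℝ, S₁ N (linActMulti (planeRot (0 : Fin 3) θ)
      (linActMulti (planeRot (0 : Fin 3) (Real.pi / 2)) Y₁)) =
        S₁ N (linActMulti (planeRot (0 : Fin 3) θ) Y₁) := by
    intro θ
    rw [← linActMulti_planeRot_add, show Real.pi / 2 + θ = θ + Real.pi / 2 from add_comm _ _,
      orbit_add_pi_div_two hhyp hY₁off θ]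
  -- the orbit function of `X` near `θ₀` is the sum of the two pieces at the angle `θ - θ₀`
  have hsplit : ∀ θ : ℝ, S₁ N (linActMulti (planeRot (0 : Fin 3) θ) X) =
      S₁ N (linActMulti (planeRot (0 : Fin 3) (θ - θ₀)) Y₀) +
        S₁ N (linActMulti (planeRot (0 : Fin 3) (θ - θ₀)) Y₁) := by
    intro θ
    have hθ : θ = θ₀ + (θ - θ₀) := by ring
    conv_lhs => rw [hθ, linActMulti_planeRot_add, hYsum, map_add, map_add]
  -- assemble
  have hstrip : ∀ (w : ℂ) (ε : ℝ), |w.re - θ₀| < ε → |(w - (θ₀ : ℂ)).re| < ε := fun w ε hw => by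
    simpa [Complex.sub_re] using hw
  refine ⟨min ε₀ ε₁, lt_min hε₀ hε₁, fun w => Φ₀ (w - θ₀) + Φ₁ (w - θ₀), C₀ + C₁, ?_, ?_, ?_⟩
  · refine DifferentiableOn.add ?_ ?_
    · refine hd₀.comp (differentiableOn_id.sub_const _) fun w hw => ?_
      exact hstrip w ε₀ (lt_of_lt_of_le hw (min_le_left _ _))
    · refine hd₁.comp (differentiableOn_id.sub_const _) fun w hw => ?_
      exact hstrip w ε₁ (lt_of_lt_of_le hw (min_le_right _ _))
  · intro w hw
    have him : (w - (θ₀ : ℂ)).im = w.im := by simp [Complex.sub_im]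
    have h₀ := hg₀ (w - θ₀) (hstrip w ε₀ (lt_of_lt_of_le hw (min_le_left _ _)))
    have h₁ := hg₁ (w - θ₀) (hstrip w ε₁ (lt_of_lt_of_le hw (min_le_right _ _)))
    rw [him] at h₀ h₁
    calc ‖Φ₀ (w - θ₀) + Φ₁ (w - θ₀)‖ ≤ ‖Φ₀ (w - θ₀)‖ + ‖Φ₁ (w - θ₀)‖ := norm_add_le _ _
      _ ≤ C₀ * Real.exp (Nₑ * |w.im|) + C₁ * Real.exp (Nₑ * |w.im|) := add_le_add h₀ h₁
      _ = (C₀ + C₁) * Real.exp (Nₑ * |w.im|) := by ring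
  · intro θ hθ
    have hcast : (θ : ℂ) - (θ₀ : ℂ) = ((θ - θ₀ : ℝ) : ℂ) := by push_cast; ring
    beta_reduce
    rw [hcast, hf₀ (θ - θ₀) (lt_of_lt_of_le hθ (min_le_left _ _)),
      hf₁ (θ - θ₀) (lt_of_lt_of_le hθ (min_le_right _ _)), horb₁, hsplit θ]

end OrbitBandlimit

/-- **Stub 3c — FROM THE `e₀`-FRAME AT ANGLE `0` TO EVERY ANGLE (two frames and a smooth two-set partition).**
If orbit functions of compactly supported test functions with `e₀`-generic support (pairwise distinct times)
extend holomorphically near the angle `0` with a uniform type, then for a compactly supported `X` whose support is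
PLANAR-generic the orbit extends holomorphically near EVERY angle `θ₀` (rotate by `θ₀`; where the `x₀`-coordinates
fail use the quarter turn, which lies in `Hypercubic`): `OrbitBandlimit.localContinuation_allAngles`. -/
theorem stub_orbitAllAngles :
    open Literature.MathematicalPhysics.QuantumLattice Literature.MathematicalPhysics.AQFT
      Literature.MathematicalPhysics.QuantumFieldTheory
      Summit.QuantumFields.YangMills.Theorems.CurvatureBoostCovariance.Negative
      Summit.QuantumFields.YangMills.Theorems.NPointIsotropy.Negative in
    ∀ (N : ℕ) (S₁ : SchwingerFamily E4), Hypercubic S₁ → ∀ (Nₑ : ℝ),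
      (∀ X : SchwartzMap (Fin N → E4) ℂ, HasCompactSupport (X : (Fin N → E4) → ℂ) →
        tsupport (X : (Fin N → E4) → ℂ) ⊆ {x | ∀ i j : Fin N, i ≠ j → x i 0 ≠ x j 0} →
        ∃ ε : ℝ, 0 < ε ∧ ∃ (Φ : ℂ → ℂ) (C : ℝ), DifferentiableOn ℂ Φ {w : ℂ | |w.re| < ε} ∧
          (∀ w : ℂ, |w.re| < ε → ‖Φ w‖ ≤ C * Real.exp (Nₑ * |w.im|)) ∧
          ∀ θ : ℝ, |θ| < ε → Φ θ = S₁ N (linActMulti (planeRot (0 : Fin 3) θ) X)) →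
      ∀ (X : SchwartzMap (Fin N → E4) ℂ), HasCompactSupport (X : (Fin N → E4) → ℂ) →
        (∀ x ∈ tsupport (X : (Fin N → E4) → ℂ), ∀ φ : ℝ,
          (∀ i j : Fin N, i ≠ j → (planeRot (0 : Fin 3) φ (x i)) 0 ≠ (planeRot (0 : Fin 3) φ (x j)) 0) ∨
          (∀ i j : Fin N, i ≠ j → (planeRot (0 : Fin 3) φ (x i)) 1 ≠ (planeRot (0 : Fin 3) φ (x j)) 1)) →
        ∀ (θ₀ : ℝ),
          ∃ ε : ℝ, 0 < ε ∧ ∃ (Φ : ℂ → ℂ) (C : ℝ), DifferentiableOn ℂ Φ {w : ℂ | |w.re - θ₀| < ε} ∧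
            (∀ w : ℂ, |w.re - θ₀| < ε → ‖Φ w‖ ≤ C * Real.exp (Nₑ * |w.im|)) ∧
            ∀ θ : ℝ, |θ - θ₀| < ε → Φ θ = S₁ N (linActMulti (planeRot (0 : Fin 3) θ) X) := by
  intro N S₁ hhyp Nₑ h0 X hXc hXg θ₀
  exact OrbitBandlimit.localContinuation_allAngles hhyp Nₑ h0 X hXc hXg θ₀

end Summit.QuantumFields.YangMills.Theorems.CurvatureBoostCovariance.BoostsInheritMirrors

end
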